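import Mathlib
import HarnessLib
import Summits.ValiantsHypothesis.ValiantsHypothesis.Theses.MonotoneRestoration
import Literature.Computability.AlgebraicComplexity.SymmetricCircuitSubstitution
import Literature.Computability.AlgebraicComplexity.SymmetricCircuitPairing
import Literature.Computability.AlgebraicComplexity.SymmetricArithCircuitNaive
import Literature.Computability.AlgebraicComplexity.SymmetricDetCircuitEval
import Literature.Computability.AlgebraicComplexity.SymmetricCircuitFold

/-! # Route MonotoneRestoration — crux `MonotoneRestorationQP`, line Sketch v10: THEOREM ζ-M
(stmt-ValiantsHypothesis-15886, lead c5)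

**Equivariant matrix calculus restores with polynomial symmetric size.**
Part of THEOREM ζ (the SIZE CALCULUS of Dawar–Wilsenach square-symmetric circuits). An
EQUIVARIANT MATRIX CIRCUIT is a labelled circuit over variables `X` (a `Sym(Fin n)`-set) with
outputs indexed by `Fin n × Fin n` (diagonal action) that is symmetric: it computes a matrix
`M(x)` with `M(σ • x) = P_σ M(x) P_σ⁻¹`. From the landed stub Z1 (substitution,
`IsSymmetric.exists_substitution`, p161502), pairing (`exists_pairing`, p154001), the naive symmetric
matrix product (`naiveMatMulCircuit`), Le Verrier's symmetric determinant circuit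
(`leVerrierCircuit`, Dawar–Wilsenach Thm 4.1) and folding (Z3, `exists_sumOutputs`, p161679):

* `zeta_symmetric_reindex` — re-indexing the outputs along an equivariant injection (same gates);
  `zeta_symmetric_transpose` — `Mᵀ`; `zeta_symmetric_diagonal` — the family `(M_ii)_i`;
* `zeta_symmetric_matMul` — `M N` on `|G_M| + |G_N| + n³ + 3n²` gates;
* `zeta_symmetric_trace` — `tr M` on `|G| + 1` gates;
* `zeta_symmetric_det` — `det M` on `|G| + (n + 2)⁴` gates (characteristic `0`);
* `qpSymmetric_det` — COROLLARY AT THE CRUX'S SCALE: determinants of quasi-polynomial-size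
  equivariant matrix circuits over `ℂ` have quasi-polynomial-size square-symmetric circuits.

With THEOREM ζ-H (homogeneous components), Z4/Z5 (Hadamard products and linear combinations of
equivariant output families) this certifies the census exclusion of leads c3/c4: every family
obtained from the variable matrix by equivariant matrix products, transposes, Hadamard products,
linear combinations, traces and determinants / characteristic coefficients has POLYNOMIAL-size
square-symmetric circuits — such constructions never refute `MonotoneRestorationQP`.
-/

noncomputable section

-- `Summit.ValiantsHypothesis.ValiantsHypothesis.…` is the tree's mandated namespace (Sub = Summit).
set_option linter.dupNamespace false

namespace Summit.ValiantsHypothesis.ValiantsHypothesis.Theorems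

open Literature.Computability.AlgebraicComplexity

/-! ### Re-indexing the outputs -/

/-- **ζ-M0 — re-indexing outputs.** Along a `Γ`-equivariant injection `e : Y' → Y` of output index
sets, a `Γ`-symmetric circuit with outputs `Y` becomes a `Γ`-symmetric circuit with outputs `Y'`
on the SAME gates (only the output designation changes). [folklore] -/
theorem zeta_symmetric_reindex {K X Y Y' Γ G : Type} [CommSemiring K] [Group Γ] [MulAction Γ X]
    [MulAction Γ Y] [MulAction Γ Y'] (C : LabelledArithCircuit K X Y G) (hC : C.IsSymmetric Γ)
    (e : Y' → Y) (he : Function.Injective e) (hequiv : ∀ (γ : Γ) (y' : Y'), e (γ • y') = γ • e y') :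
    ∃ C' : LabelledArithCircuit K X Y' G,
      C'.IsSymmetric Γ ∧ ∀ y', C'.eval (C'.output y') = C.eval (C.output (e y')) := by
  refine ⟨{ C with output := C.output ∘ e, output_injective := C.output_injective.comp he },
    fun γ => ?_, fun y' => rfl⟩
  obtain ⟨π, hπ⟩ := hC γ
  refine ⟨π, ⟨hπ.children_apply, hπ.label_apply, fun y' => ?_⟩⟩
  change C.output (e (γ • y')) = π (C.output (e y'))
  rw [hequiv, hπ.output_smul]

/-- **ζ-M1 — transpose.** If an equivariant matrix `M` is computed by a square-symmetric circuit,
so is `Mᵀ`, on the same gates. [folklore] -/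
theorem zeta_symmetric_transpose {K X G : Type} [CommSemiring K] {n : ℕ}
    [MulAction (Equiv.Perm (Fin n)) X] (C : LabelledArithCircuit K X (Fin n × Fin n) G)
    (hC : C.IsSymmetric (Equiv.Perm (Fin n))) :
    ∃ C' : LabelledArithCircuit K X (Fin n × Fin n) G,
      C'.IsSymmetric (Equiv.Perm (Fin n)) ∧
        ∀ i j, C'.eval (C'.output (i, j)) = C.eval (C.output (j, i)) := by
  obtain ⟨C', h', hev'⟩ := zeta_symmetric_reindex C hC Prod.swap Prod.swap_injective
    (fun γ p => by rfl)
  exact ⟨C', h', fun i j => hev' (i, j)⟩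

/-- **ζ-M2 — diagonal.** If an equivariant matrix `M` is computed by a square-symmetric circuit,
the family of its diagonal entries `(M_ii)_{i < n}` (outputs indexed by `Fin n`) is computed on the
same gates. [folklore] -/
theorem zeta_symmetric_diagonal {K X G : Type} [CommSemiring K] {n : ℕ}
    [MulAction (Equiv.Perm (Fin n)) X] (C : LabelledArithCircuit K X (Fin n × Fin n) G)
    (hC : C.IsSymmetric (Equiv.Perm (Fin n))) :
    ∃ C' : LabelledArithCircuit K X (Fin n) G,
      C'.IsSymmetric (Equiv.Perm (Fin n)) ∧ ∀ i, C'.eval (C'.output i) = C.eval (C.output (i, i)) :=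
  zeta_symmetric_reindex C hC (fun i => (i, i)) (fun _ _ h => (Prod.ext_iff.1 h).1)
    (fun _ _ => rfl)

/-! ### Products, traces, determinants -/

/-- **ζ-M3 — PRODUCTS OF EQUIVARIANT MATRIX CIRCUITS.** If equivariant matrices `M`, `N` are
computed by square-symmetric circuits on `|G_M|`, `|G_N|` gates over the same `Sym(Fin n)`-set of
variables, then `M N` is computed by a square-symmetric circuit on at most
`|G_M| + |G_N| + n³ + 3n²` gates: pair the two circuits (outputs `(Fin n × Fin n) ⊕ (Fin n × Fin n)`,
the variable set of the naive symmetric matrix-product circuit) and substitute into the latter (Z1).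
[folklore] -/
theorem zeta_symmetric_matMul {K X G₁ G₂ : Type} [CommSemiring K] {n : ℕ}
    [MulAction (Equiv.Perm (Fin n)) X] [Fintype G₁] [Fintype G₂]
    (CM : LabelledArithCircuit K X (Fin n × Fin n) G₁) (CN : LabelledArithCircuit K X (Fin n × Fin n) G₂)
    (hM : CM.IsSymmetric (Equiv.Perm (Fin n))) (hN : CN.IsSymmetric (Equiv.Perm (Fin n))) :
    ∃ (G' : Type) (_ : Fintype G') (C' : LabelledArithCircuit K X (Fin n × Fin n) G'),
      C'.IsSymmetric (Equiv.Perm (Fin n)) ∧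
      (∀ i k, C'.eval (C'.output (i, k)) =
        ∑ j : Fin n, CM.eval (CM.output (i, j)) * CN.eval (CN.output (j, k))) ∧
      Fintype.card G' ≤ Fintype.card G₁ + Fintype.card G₂ + n ^ 3 + 3 * n ^ 2 := by
  obtain ⟨G₀, i₀, C₀, h₀, hinl, hinr, hc₀⟩ := hM.exists_pairing hN
  obtain ⟨G', i', C', h', hev', hc'⟩ :=
    h₀.exists_substitution (naiveMatMulCircuit K n).isSymmetric
  refine ⟨G', i', C', h', fun i k => ?_, ?_⟩
  · rw [hev' (i, k)]
    have hout : (naiveMatMulCircuit K n).toLabelledArithCircuit.eval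
        ((naiveMatMulCircuit K n).toLabelledArithCircuit.output (i, k)) = matMulEntry K i k :=
      computesMatrixProduct_naiveMatMulCircuit K n (i, k)
    rw [hout, matMulEntry, map_sum]
    refine Finset.sum_congr rfl fun j _ => ?_
    rw [map_mul, MvPolynomial.aeval_X, MvPolynomial.aeval_X, hinl, hinr]
  · have hsz : Fintype.card (NaiveMatMulGate n) = 2 * n ^ 2 + n ^ 3 + n ^ 2 :=
      size_naiveMatMulCircuit K n
    calc Fintype.card G' ≤ Fintype.card G₀ + Fintype.card (NaiveMatMulGate n) := hc'
      _ ≤ Fintype.card G₁ + Fintype.card G₂ + n ^ 3 + 3 * n ^ 2 := by rw [hsz]; omega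

/-- **ζ-M4 — trace.** If an equivariant `n × n` matrix `M` (`1 ≤ n`) is computed by a
square-symmetric circuit on `|G|` gates, its trace is computed by a square-symmetric single-output
circuit on at most `|G| + 1` gates (diagonal, then fold Z3). [folklore] -/
theorem zeta_symmetric_trace {K X G : Type} [CommSemiring K] {n : ℕ} [NeZero n]
    [MulAction (Equiv.Perm (Fin n)) X] [MulAction (Equiv.Perm (Fin n)) Unit] [Fintype G]
    (C : LabelledArithCircuit K X (Fin n × Fin n) G) (hC : C.IsSymmetric (Equiv.Perm (Fin n))) :
    ∃ (G' : Type) (_ : Fintype G') (C' : LabelledArithCircuit K X Unit G'),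
      C'.IsSymmetric (Equiv.Perm (Fin n)) ∧
      C'.eval (C'.output ()) = ∑ i : Fin n, C.eval (C.output (i, i)) ∧
      Fintype.card G' ≤ Fintype.card G + 1 := by
  obtain ⟨Cd, hd, hevd⟩ := zeta_symmetric_diagonal C hC
  obtain ⟨G', i', C', h', hev', hc'⟩ := hd.exists_sumOutputs
  exact ⟨G', i', C', h', by rw [hev']; exact Finset.sum_congr rfl fun i _ => hevd i, hc'⟩

/-- **ζ-M5 — DETERMINANTS OF EQUIVARIANT MATRIX CIRCUITS** (Z1 + Le Verrier, Dawar–Wilsenach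
Thm 4.1 in the tree as `leVerrierCircuit`): over a field of characteristic `0`, if an equivariant
matrix `M` is computed by a square-symmetric circuit on `|G|` gates, then `det M` is computed by a
square-symmetric single-output circuit on at most `|G| + (n + 2)⁴` gates. [folklore] -/
theorem zeta_symmetric_det {K X G : Type} [Field K] [CharZero K] {n : ℕ}
    [MulAction (Equiv.Perm (Fin n)) X] [MulAction (Equiv.Perm (Fin n)) Unit] [Fintype G]
    (C : LabelledArithCircuit K X (Fin n × Fin n) G) (hC : C.IsSymmetric (Equiv.Perm (Fin n))) :
    ∃ (G' : Type) (_ : Fintype G') (C' : LabelledArithCircuit K X Unit G'),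
      C'.IsSymmetric (Equiv.Perm (Fin n)) ∧
      C'.eval (C'.output ()) = (Matrix.of fun i j => C.eval (C.output (i, j))).det ∧
      Fintype.card G' ≤ Fintype.card G + (n + 2) ^ 4 := by
  obtain ⟨G₂, i₂, C₂, h₂, hev₂, hc₂⟩ := exists_isSymmetric_circuit_detPoly K n
  obtain ⟨G', i', C', h', hev', hc'⟩ := hC.exists_substitution h₂
  refine ⟨G', i', C', h', ?_, hc'.trans (by omega)⟩
  rw [hev' (), hev₂, detPoly, AlgHom.map_det]
  congr 1
  ext i j
  simp [Matrix.mvPolynomialX, AlgHom.mapMatrix_apply]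

/-! ### Quasi-polynomial bookkeeping and the corollary at the crux's scale -/

/-- Quasi-polynomial bookkeeping for ζ-M: `2^{(L + c)^c} + (n+2)^4 ≤ 2^{(L + c + 5)^{c + 5}}`,
`L = log₂ n`. [folklore] -/
theorem zeta_qp_add_pow_four_le (c n : ℕ) :
    2 ^ ((Nat.log 2 n + c) ^ c) + (n + 2) ^ 4 ≤ 2 ^ ((Nat.log 2 n + (c + 5)) ^ (c + 5)) := by
  have hL : n < 2 ^ (Nat.log 2 n + 1) := Nat.lt_pow_succ_log_self Nat.one_lt_two n
  generalize Nat.log 2 n = L at hL ⊢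
  set B : ℕ := L + (c + 5) with hB
  have hB5 : 5 ≤ B := by omega
  have hB1 : 1 ≤ B := by omega
  have hmono : ∀ i j : ℕ, i ≤ j → B ^ i ≤ B ^ j := fun i j hij => Nat.pow_le_pow_right hB1 hij
  have hn2 : n + 2 ≤ 2 ^ (L + 2) := by
    have : 2 ^ (L + 2) = 2 ^ (L + 1) * 2 := by ring
    omega
  have h4 : (n + 2) ^ 4 ≤ 2 ^ (4 * (L + 2)) := by
    calc (n + 2) ^ 4 ≤ (2 ^ (L + 2)) ^ 4 := Nat.pow_le_pow_left hn2 4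
      _ = 2 ^ (4 * (L + 2)) := by rw [← pow_mul, mul_comm]
  -- both exponents are ≤ B^(c+4), and 2^E + 2^E' ≤ 2^(max+1)
  have hE1 : (L + c) ^ c ≤ B ^ (c + 4) :=
    (Nat.pow_le_pow_left (by omega) c).trans (hmono c (c + 4) (by omega))
  have hE2 : 4 * (L + 2) ≤ B ^ (c + 4) := by
    calc 4 * (L + 2) ≤ B * B := Nat.mul_le_mul (by omega) (by omega)
      _ = B ^ 2 := (sq B).symm
      _ ≤ B ^ (c + 4) := hmono 2 (c + 4) (by omega)
  have hsum : B ^ (c + 4) + 1 ≤ B ^ (c + 5) := by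
    have : 2 * B ^ (c + 4) ≤ B ^ (c + 5) := by
      calc 2 * B ^ (c + 4) ≤ B * B ^ (c + 4) := Nat.mul_le_mul_right _ (by omega)
        _ = B ^ (c + 5) := by ring
    have h1 : 1 ≤ B ^ (c + 4) := Nat.one_le_pow _ _ hB1
    omega
  calc 2 ^ ((L + c) ^ c) + (n + 2) ^ 4 ≤ 2 ^ (B ^ (c + 4)) + 2 ^ (B ^ (c + 4)) :=
        Nat.add_le_add (Nat.pow_le_pow_right (by norm_num) hE1)
          (h4.trans (Nat.pow_le_pow_right (by norm_num) hE2))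
    _ = 2 ^ (B ^ (c + 4) + 1) := by ring
    _ ≤ 2 ^ (B ^ (c + 5)) := Nat.pow_le_pow_right (by norm_num) hsum

/-- **THEOREM ζ-M — DETERMINANTS OF EQUIVARIANT MATRIX CIRCUITS RESTORE AT QUASI-POLYNOMIAL
COST.** If `(M_n)` is a family of equivariant `n × n` matrices over `ℂ` whose entries are computed
by square-symmetric circuits (outputs `Fin n × Fin n`) of quasi-polynomial size
`2^{(log₂ n + c)^c}`, then `n ↦ det M_n` has square-symmetric single-output circuits of
quasi-polynomial size. (Le Verrier on top of Z1; the same holds with polynomial bounds throughout.)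
Every "linear algebra over an equivariantly built matrix" witness proposed against the crux falls
in this class. [folklore] -/
theorem qpSymmetric_det :
    ∀ (M : (n : ℕ) → Matrix (Fin n) (Fin n) (MvPolynomial (Fin n × Fin n) ℂ)),
      (∃ c : ℕ, ∀ n : ℕ, ∃ (G : Type) (_ : Fintype G)
        (C : LabelledArithCircuit ℂ (Fin n × Fin n) (Fin n × Fin n) G),
        C.IsSymmetric (Equiv.Perm (Fin n)) ∧ (∀ i j, C.eval (C.output (i, j)) = M n i j) ∧
          Fintype.card G ≤ 2 ^ ((Nat.log 2 n + c) ^ c)) →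
      ∃ c : ℕ, ∀ n : ℕ, ∃ (G : Type) (_ : Fintype G)
        (C : LabelledArithCircuit ℂ (Fin n × Fin n) Unit G),
        C.IsSymmetric (Equiv.Perm (Fin n)) ∧ C.eval (C.output ()) = (M n).det ∧
          Fintype.card G ≤ 2 ^ ((Nat.log 2 n + c) ^ c) := by
  intro M hM
  obtain ⟨c, hc⟩ := hM
  refine ⟨c + 5, fun n => ?_⟩
  obtain ⟨G, inst, C, hsym, hev, hcard⟩ := hc n
  obtain ⟨G', i', C', h', hev', hc'⟩ := zeta_symmetric_det C hsym
  refine ⟨G', i', C', h', ?_, (hc'.trans (Nat.add_le_add_right hcard _)).trans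
    (zeta_qp_add_pow_four_le c n)⟩
  rw [hev']
  congr 1
  exact Matrix.ext fun i j => hev i j

end Summit.ValiantsHypothesis.ValiantsHypothesis.Theorems

end
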